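import Literature.MathematicalPhysics.QuantumFieldTheory.TorusChartCurlPrimitive
import HarnessLib

/-!
# Centred sweep primitives on a charted torus: the algebra

`TorusChartCurlPrimitive.lean` proves that an alternating, closed, zero-flux `2`-cochain `q` on a charted torus
`F : TorusChart Λ d` is a curl, `q = d₁ θ`, by sweeping out one direction at a time with the cochain `sweep κ q`
(partial sums of the rows `q(·; κ, j)` along direction `κ` from the slice `{x_κ = 0}`, plus a seam corrector on the
last layer `{x_κ = N_κ - 1}`).  For the estimates of constructive field theory (a potential `θ` is fed into an
exponentially localised kernel, [BalabanImbrieJaffe1985] p. 326 *"by change of gauge u_k can be transformed in a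
local region Λ into a configuration of the form exp[ie_kηA], where A is smooth and small"*, [BalabanImbrieJaffe1988]
(6.1.5)) one needs a primitive whose SIZE is controlled by the distance to a chosen centre, uniformly in the volume.
This file sets up the CENTRED variant of the sweep (the sizes are in `TorusChartCurlPrimitiveGrowth.lean`):

* `TorusChart.mid F κ x` — the point of the `κ`-line through `x` on the centre layer `{x_κ = ⌊N_κ/2⌋}`;
* `TorusChart.corr F κ q` — the partial sums of the rows from the slice up to the centre layer (constant along
  `κ`-lines, no `κ`-component), and `TorusChart.csweep F κ q = sweep κ q - corr κ q` — the **centred sweep**: partial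
  sums restarted at the centre layer; the seam mechanism of `sweep` is untouched (`d₁_corr_row`, `d₁_csweep_row`);
* the TELESCOPED transverse curls `d₁_sweep_of_ne`, `d₁_corr_of_ne`, `d₁_csweep_of_ne` (closedness on the cells
  `(κ, i, j)` summed along the `κ`-line; the tree's `d₁_sweep_below` is the special case of vanishing rows);
* `TorusChart.crem F κ q = q - d₁ (csweep κ q)` — the remainder, EXPLICITLY `q (mid κ x; i, j)` off the pairs involving
  `κ` and `0` on them (`crem_apply`); it is alternating, closed, and has the fluxes of `q`;
* `TorusChart.const₂` — constant `2`-cochains, closed, with flux `N_j N_i •` value (`flux_const₂`).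

Everything is proved; no named fact is introduced; the statements are elementary (discrete de Rham calculus) and carry the
locator of the gauge choice of [BalabanImbrieJaffe1985] p. 326 which they implement (private plumbing is [folklore]).
statement-level skeleton of published theorems with citation tags; proofs where landed; nothing here is a claim about the
Yang–Mills mass gap.

## References

* B. Eckmann, Comment. Math. Helv. 17 (1945) 240–255 (cohomology of finite cell complexes). [folklore form]
* T. Bałaban, J. Imbrie, A. Jaffe, Commun. Math. Phys. 97 (1985) 299–329, p. 326. [BalabanImbrieJaffe1985]
* T. Bałaban, J. Imbrie, A. Jaffe, Commun. Math. Phys. 114 (1988) 257–315, (6.1.5). [BalabanImbrieJaffe1988]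
-/

namespace Literature.MathematicalPhysics.QuantumFieldTheory

open scoped BigOperators

namespace TorusChart

variable {Λ : Type*} [AddCommGroup Λ] {d : ℕ} (F : TorusChart Λ d)


section Algebra

variable {A : Type*} [AddCommGroup A]

/-! ## Telescoping along a line; the centre layer -/

/-- **Telescoping of the axial partial sum**: `axSum κ (h(· + e_κ) - h) x = h x - h (foot of x)`. [cite: BalabanImbrieJaffe1985, §7.3 p.326] -/
theorem axSum_sub_add_gen_self (κ : Fin d) (h : Λ → A) (x : Λ) :
    F.axSum κ (fun y => h (y + F.gen κ) - h y) x = h x - h (F.dropCoord κ x) := by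
  rw [axSum_def]
  have hsum := Finset.sum_range_sub (fun m : ℕ => h (F.dropCoord κ x + m • F.gen κ)) (F.cval κ x)
  simp only [succ_nsmul, ← add_assoc] at hsum
  rw [hsum, zero_nsmul, add_zero, dropCoord_add_cval_nsmul]

/-- The point of the `κ`-line through `x` on the **centre layer** `{x_κ = ⌊N_κ/2⌋}`. [cite: BalabanImbrieJaffe1985, §7.3 p.326] -/
def mid (κ : Fin d) (x : Λ) : Λ := F.dropCoord κ x + (F.period κ / 2) • F.gen κ

/-- The centre point has the same foot as `x`. [cite: BalabanImbrieJaffe1985, §7.3 p.326] -/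
theorem dropCoord_mid (κ : Fin d) (x : Λ) : F.dropCoord κ (F.mid κ x) = F.dropCoord κ x := by
  rw [mid, dropCoord_add_nsmul_gen_self, F.dropCoord_of_cval_eq_zero (F.cval_dropCoord_self κ x)]

/-- The `κ`-coordinate of the centre point is `⌊N_κ/2⌋`. [cite: BalabanImbrieJaffe1985, §7.3 p.326] -/
theorem cval_mid_self (κ : Fin d) (x : Λ) : F.cval κ (F.mid κ x) = F.period κ / 2 := by
  rw [mid, cval_add_nsmul_gen_self, cval_dropCoord_self, zero_add,
    Nat.mod_eq_of_lt (Nat.div_lt_self (F.period_pos κ) one_lt_two)]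

/-- The transverse coordinates of the centre point are those of `x`. [cite: BalabanImbrieJaffe1985, §7.3 p.326] -/
theorem cval_mid_of_ne {i κ : Fin d} (hiκ : i ≠ κ) (x : Λ) : F.cval i (F.mid κ x) = F.cval i x := by
  rw [mid, F.cval_add_nsmul_gen_of_ne hiκ, F.cval_dropCoord_of_ne hiκ]

/-- The centre point does not move under a step along the line. [cite: BalabanImbrieJaffe1985, §7.3 p.326] -/
theorem mid_add_gen_self (κ : Fin d) (x : Λ) : F.mid κ (x + F.gen κ) = F.mid κ x := by
  rw [mid, mid, dropCoord_add_gen_self]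

/-- The centre point moves along with a transverse step. [cite: BalabanImbrieJaffe1985, §7.3 p.326] -/
theorem mid_add_gen_of_ne {i κ : Fin d} (hiκ : i ≠ κ) (x : Λ) : F.mid κ (x + F.gen i) = F.mid κ x + F.gen i := by
  rw [mid, mid, F.dropCoord_add_gen_of_ne hiκ, add_right_comm]

/-! ## The corrector and the centred sweep -/

/-- The **corrector**: for `j ≠ κ` the partial sum of the row `q(·; κ, j)` from the slice up to the centre layer (a
function of the `κ`-line only); `0` in direction `κ`. [cite: BalabanImbrieJaffe1985, §7.3 p.326] -/
def corr (κ : Fin d) (q : Λ → Fin d → Fin d → A) : Λ → Fin d → A :=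
  fun x j => if j = κ then 0 else F.axSum κ (fun y => q y κ j) (F.mid κ x)

/-- The **centred sweep cochain**: `sweep κ q` with the partial sums restarted at the centre layer. [cite: BalabanImbrieJaffe1985, §7.3 p.326] -/
noncomputable def csweep (κ : Fin d) (q : Λ → Fin d → Fin d → A) : Λ → Fin d → A := F.sweep κ q - F.corr κ q

/-- The corrector has no `κ`-component. [cite: BalabanImbrieJaffe1985, §7.3 p.326] -/
theorem corr_self (κ : Fin d) (q : Λ → Fin d → Fin d → A) (x : Λ) : F.corr κ q x κ = 0 := by
  rw [corr, if_pos rfl]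

/-- The corrector in a direction `j ≠ κ`. [cite: BalabanImbrieJaffe1985, §7.3 p.326] -/
theorem corr_of_ne (κ : Fin d) (q : Λ → Fin d → Fin d → A) (x : Λ) {j : Fin d} (hj : j ≠ κ) :
    F.corr κ q x j = F.axSum κ (fun y => q y κ j) (F.mid κ x) := by
  rw [corr, if_neg hj]

/-- The corrector is constant along `κ`-lines. [cite: BalabanImbrieJaffe1985, §7.3 p.326] -/
theorem corr_add_gen_self (κ : Fin d) (q : Λ → Fin d → Fin d → A) (x : Λ) (j : Fin d) :
    F.corr κ q (x + F.gen κ) j = F.corr κ q x j := by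
  simp only [corr, mid_add_gen_self]

/-- The centred sweep in a direction `j ≠ κ`: the partial sum from the centre layer (difference of two partial sums from
the slice along the same line). [cite: BalabanImbrieJaffe1985, §7.3 p.326] -/
theorem csweep_of_ne (κ : Fin d) (q : Λ → Fin d → Fin d → A) (x : Λ) {j : Fin d} (hj : j ≠ κ) :
    F.csweep κ q x j = F.axSum κ (fun y => q y κ j) x - F.axSum κ (fun y => q y κ j) (F.mid κ x) := by
  rw [csweep, Pi.sub_apply, Pi.sub_apply, F.sweep_of_ne κ q x hj, F.corr_of_ne κ q x hj]

/-- The centred sweep in direction `κ` is the seam corrector of `sweep`. [cite: BalabanImbrieJaffe1985, §7.3 p.326] -/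
theorem csweep_self (κ : Fin d) (q : Λ → Fin d → Fin d → A) (x : Λ) :
    F.csweep κ q x κ = if F.cval κ x + 1 = F.period κ then F.prim (F.rowCirc κ q) x else 0 := by
  rw [csweep, Pi.sub_apply, Pi.sub_apply, corr_self, sub_zero, sweep_self]

/-- The corrector has zero curl on the rows `(κ, j)`. [cite: BalabanImbrieJaffe1985, §7.3 p.326] -/
theorem d₁_corr_row (κ : Fin d) (q : Λ → Fin d → Fin d → A) (x : Λ) (j : Fin d) : F.d₁ (F.corr κ q) x κ j = 0 := by
  rw [d₁_apply, corr_self, corr_self, corr_add_gen_self]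
  abel

variable {F} in
/-- Closedness on the cell `(y; κ, i, j)`: `∂_i q_{κj} - ∂_j q_{κi} = ∂_κ q_{ij}`. [folklore] -/
private theorem cell_of_d₂ {q : Λ → Fin d → Fin d → A} (hq : F.d₂ q = 0) (κ i j : Fin d) (y : Λ) :
    (q (y + F.gen i) κ j - q y κ j) - (q (y + F.gen j) κ i - q y κ i) = q (y + F.gen κ) i j - q y i j := by
  have h := congr_fun (congr_fun (congr_fun (congr_fun hq y) κ) i) j
  simp only [d₂_apply, Pi.zero_apply] at h
  rw [← sub_eq_zero, ← neg_eq_zero, ← h]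
  abel

variable {F} in
/-- The common computation behind the transverse curls of `sweep` and `corr`: the four partial sums of a closed `q`
along the `κ`-line through `z` telescope to `q (z; i, j) - q (foot; i, j)`. [folklore] -/
private theorem axSum_four_eq {q : Λ → Fin d → Fin d → A} (hq : F.d₂ q = 0) (κ i j : Fin d) (z : Λ) :
    F.axSum κ (fun y => q y κ i) z + F.axSum κ (fun y => q (y + F.gen i) κ j) z
      - F.axSum κ (fun y => q (y + F.gen j) κ i) z - F.axSum κ (fun y => q y κ j) z =
      q z i j - q (F.dropCoord κ z) i j := by
  rw [← F.axSum_sub_add_gen_self κ (fun y => q y i j) z]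
  have hfun : (fun y => q (y + F.gen κ) i j - q y i j) =
      fun y => (q (y + F.gen i) κ j - q y κ j) - (q (y + F.gen j) κ i - q y κ i) :=
    funext fun y => (cell_of_d₂ hq κ i j y).symm
  rw [hfun]
  simp only [axSum_sub]
  abel

variable {F} in
/-- **The transverse curl of `sweep`**: `d₁ (sweep κ q) (x; i, j) = q (x; i, j) - q (foot of x; i, j)` for `i, j ≠ κ` and
closed `q` (the telescoped form of `TorusChartCurlPrimitive.d₁_sweep_below`). [cite: BalabanImbrieJaffe1985, §7.3 p.326] -/
theorem d₁_sweep_of_ne (κ : Fin d) {q : Λ → Fin d → Fin d → A} (hq : F.d₂ q = 0) (x : Λ) {i j : Fin d}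
    (hi : i ≠ κ) (hj : j ≠ κ) : F.d₁ (F.sweep κ q) x i j = q x i j - q (F.dropCoord κ x) i j := by
  rw [d₁_apply, F.sweep_of_ne κ q x hi, F.sweep_of_ne κ q _ hj, F.sweep_of_ne κ q _ hi, F.sweep_of_ne κ q x hj,
    F.axSum_add_gen_of_ne hi, F.axSum_add_gen_of_ne hj]
  exact axSum_four_eq hq κ i j x

variable {F} in
/-- **The transverse curl of the corrector**: `d₁ (corr κ q) (x; i, j) = q (mid κ x; i, j) - q (foot of x; i, j)` for
`i, j ≠ κ` and closed `q`. [cite: BalabanImbrieJaffe1985, §7.3 p.326] -/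
theorem d₁_corr_of_ne (κ : Fin d) {q : Λ → Fin d → Fin d → A} (hq : F.d₂ q = 0) (x : Λ) {i j : Fin d}
    (hi : i ≠ κ) (hj : j ≠ κ) : F.d₁ (F.corr κ q) x i j = q (F.mid κ x) i j - q (F.dropCoord κ x) i j := by
  rw [d₁_apply, F.corr_of_ne κ q x hi, F.corr_of_ne κ q _ hj, F.corr_of_ne κ q _ hi, F.corr_of_ne κ q x hj,
    F.mid_add_gen_of_ne hi, F.mid_add_gen_of_ne hj, F.axSum_add_gen_of_ne hi, F.axSum_add_gen_of_ne hj,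
    ← F.dropCoord_mid κ x]
  exact axSum_four_eq hq κ i j (F.mid κ x)

variable {F} in
/-- **The transverse curl of the centred sweep**: `d₁ (csweep κ q) (x; i, j) = q (x; i, j) - q (mid κ x; i, j)` for
`i, j ≠ κ`. [cite: BalabanImbrieJaffe1985, §7.3 p.326] -/
theorem d₁_csweep_of_ne (κ : Fin d) {q : Λ → Fin d → Fin d → A} (hq : F.d₂ q = 0) (x : Λ) {i j : Fin d}
    (hi : i ≠ κ) (hj : j ≠ κ) : F.d₁ (F.csweep κ q) x i j = q x i j - q (F.mid κ x) i j := by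
  rw [csweep, d₁_sub, Pi.sub_apply, Pi.sub_apply, Pi.sub_apply, d₁_sweep_of_ne κ hq x hi hj,
    d₁_corr_of_ne κ hq x hi hj]
  abel

variable {F} in
/-- **The centred sweep produces the rows**: `d₁ (csweep κ q) (x; κ, j) = q (x; κ, j)`, `j ≠ κ`, for closed `q` with
vanishing fluxes out of direction `κ`. [cite: BalabanImbrieJaffe1985, §7.3 p.326] -/
theorem d₁_csweep_row (κ : Fin d) {q : Λ → Fin d → Fin d → A} (hq : F.d₂ q = 0) (hflux : ∀ j, F.flux q κ j = 0)
    (x : Λ) {j : Fin d} (hj : j ≠ κ) : F.d₁ (F.csweep κ q) x κ j = q x κ j := by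
  rw [csweep, d₁_sub, Pi.sub_apply, Pi.sub_apply, Pi.sub_apply, d₁_sweep_row κ hq hflux x hj, d₁_corr_row,
    sub_zero]

/-! ## The remainder -/

/-- The **remainder** after the centred sweep in direction `κ`. [cite: BalabanImbrieJaffe1985, §7.3 p.326] -/
noncomputable def crem (κ : Fin d) (q : Λ → Fin d → Fin d → A) : Λ → Fin d → Fin d → A :=
  q - F.d₁ (F.csweep κ q)

variable {F} in
/-- **The remainder, explicitly**: `0` on the pairs involving `κ`, and `q` read at the centre point of the `κ`-line on
the other pairs. [cite: BalabanImbrieJaffe1985, §7.3 p.326] -/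
theorem crem_apply (κ : Fin d) {q : Λ → Fin d → Fin d → A} (halt : IsAlt₂ q) (hq : F.d₂ q = 0)
    (hflux : ∀ j, F.flux q κ j = 0) (x : Λ) (i j : Fin d) :
    F.crem κ q x i j = if i = κ ∨ j = κ then 0 else q (F.mid κ x) i j := by
  have hrow : ∀ j', F.crem κ q x κ j' = 0 := fun j' => by
    rw [crem, Pi.sub_apply, Pi.sub_apply, Pi.sub_apply]
    by_cases hj' : j' = κ
    · rw [hj', halt.diag, d₁_self, sub_zero]
    · rw [d₁_csweep_row κ hq hflux x hj', sub_self]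
  by_cases hi : i = κ
  · subst hi
    rw [if_pos (Or.inl rfl)]
    exact hrow j
  by_cases hj : j = κ
  · subst hj
    rw [if_pos (Or.inr rfl)]
    have h := hrow i
    rw [crem, Pi.sub_apply, Pi.sub_apply, Pi.sub_apply] at h ⊢
    rw [halt.swap, d₁_swap, ← neg_sub', h, neg_zero]  -- `-(a) - -(b) = -(a - b)`
  · rw [if_neg (not_or.2 ⟨hi, hj⟩), crem, Pi.sub_apply, Pi.sub_apply, Pi.sub_apply, d₁_csweep_of_ne κ hq x hi hj]
    abel

variable {F} in
/-- The remainder vanishes on the rows `(κ, ·)`. [cite: BalabanImbrieJaffe1985, §7.3 p.326] -/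
theorem crem_row (κ : Fin d) {q : Λ → Fin d → Fin d → A} (halt : IsAlt₂ q) (hq : F.d₂ q = 0)
    (hflux : ∀ j, F.flux q κ j = 0) (x : Λ) (j : Fin d) : F.crem κ q x κ j = 0 := by
  rw [crem_apply κ halt hq hflux, if_pos (Or.inl rfl)]

variable {F} in
/-- The remainder inherits identically vanishing pairs (the directions already swept). [cite: BalabanImbrieJaffe1985, §7.3 p.326] -/
theorem crem_of_vanish (κ : Fin d) {q : Λ → Fin d → Fin d → A} (halt : IsAlt₂ q) (hq : F.d₂ q = 0)
    (hflux : ∀ j, F.flux q κ j = 0) {i j : Fin d} (hv : ∀ y, q y i j = 0) (x : Λ) : F.crem κ q x i j = 0 := by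
  rw [crem_apply κ halt hq hflux]
  split_ifs
  · rfl
  · exact hv _

variable {F} in
/-- The remainder is alternating. [cite: BalabanImbrieJaffe1985, §7.3 p.326] -/
theorem isAlt₂_crem (κ : Fin d) {q : Λ → Fin d → Fin d → A} (halt : IsAlt₂ q) : IsAlt₂ (F.crem κ q) :=
  halt.sub (F.isAlt₂_d₁ _)

/-- The remainder is closed. [cite: BalabanImbrieJaffe1985, §7.3 p.326] -/
theorem d₂_crem (κ : Fin d) {q : Λ → Fin d → Fin d → A} (hq : F.d₂ q = 0) : F.d₂ (F.crem κ q) = 0 := by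
  rw [crem, d₂_sub, hq, d₂_d₁, sub_zero]

/-- The remainder has the fluxes of `q`. [cite: BalabanImbrieJaffe1985, §7.3 p.326] -/
theorem flux_crem (κ : Fin d) (q : Λ → Fin d → Fin d → A) (i j : Fin d) :
    F.flux (F.crem κ q) i j = F.flux q i j := by
  rw [crem, flux_sub, flux_d₁, sub_zero]

/-! ## Constant `2`-cochains -/

/-- The **constant `2`-cochain** with values `h i j` (the chart `F` only fixes the carrier). [cite: BalabanImbrieJaffe1985, §7.3 p.326] -/
def const₂ (_F : TorusChart Λ d) (h : Fin d → Fin d → A) : Λ → Fin d → Fin d → A := fun _ i j => h i j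

omit [AddCommGroup A] in
/-- Unfolding `const₂`. [cite: BalabanImbrieJaffe1985, §7.3 p.326] -/
@[simp] theorem const₂_apply (h : Fin d → Fin d → A) (x : Λ) (i j : Fin d) : F.const₂ h x i j = h i j := rfl

/-- Constant cochains are closed. [cite: BalabanImbrieJaffe1985, §7.3 p.326] -/
theorem d₂_const₂ (h : Fin d → Fin d → A) : F.d₂ (F.const₂ h) = 0 := by
  funext x i j k
  simp only [d₂_apply, const₂_apply, Pi.zero_apply, sub_self, add_zero]

/-- A constant cochain is alternating iff its value is. [cite: BalabanImbrieJaffe1985, §7.3 p.326] -/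
theorem isAlt₂_const₂ {h : Fin d → Fin d → A} (h0 : ∀ i, h i i = 0) (hsw : ∀ i j, h j i = -h i j) :
    IsAlt₂ (F.const₂ h) :=
  ⟨fun _ i => h0 i, fun _ i j => hsw i j⟩

/-- **The flux of a constant cochain** is `N_j N_i` copies of its value. [cite: BalabanImbrieJaffe1985, §7.3 p.326] -/
theorem flux_const₂ (h : Fin d → Fin d → A) (i j : Fin d) :
    F.flux (F.const₂ h) i j = (F.period j * F.period i) • h i j := by
  rw [flux_def]
  simp only [circSum_def, const₂_apply, Finset.sum_const, Finset.card_range, mul_nsmul']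

end Algebra

end TorusChart

end Literature.MathematicalPhysics.QuantumFieldTheory
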